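import Literature.AlgebraicGeometry.Motives.AbelianVarietyGoodReductionHomCofinite
import Literature.AlgebraicGeometry.Motives.AbelianVarietyTateSpecialisationOfReduction
import Literature.NumberTheory.DiophantineGeometry.AbelianSchemeModelReductionTorsionBijective
import Literature.NumberTheory.DiophantineGeometry.AbelianSchemeModelReductionInertia
import Literature.NumberTheory.DiophantineGeometry.AbelianSchemeModelReductionFrobenius
import Literature.NumberTheory.DiophantineGeometry.AbelianSchemeModelReductionNaturality
import Literature.AlgebraicGeometry.Motives.TateModuleOfTorsionEquivs
import Literature.NumberTheory.GaloisRepresentations.DecompositionGroupOfCompletion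
import HarnessLib

/-!
# The produced good-reduction datum of an abelian-scheme model, NAMED; Tate-compatible simultaneous specialisation of a family

Cell `hodgecm-mathlib`, E4 (S5c′) pieces Q0–Q2 (director g3 BATCH 87/90, lead B-p20, map B-p09 READFIRST-E4).  Until now the
produced good-reduction datum of an abelian-scheme model `𝒜` of `A` at `v` lived inside three sealed existentials
(`exists_goodReductionAt_homReduction_of_isAbelianSchemeModel` R/H, `…_conjFrob` R/H/Hγ/Hγ′, `…_tateSpecialisation_…` R/T),
which cannot be recombined after the fact.  This file NAMES the datum and its companions, so that every further datum (pair
data, `ℓ`-adic specialisations for each `ℓ`, Frobenius conjugates, …) is a separate declaration OVER THE SAME TERM: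

* `IsAbelianSchemeModel.neronLift h h' f : 𝒜 ⟶ ℬ` — the Néron lift of `f : A → B` (generic fibre `e_𝒜 ≫ f ≫ e_ℬ⁻¹` through
  the models' chosen generic isomorphisms; unique, a group homomorphism, functorial, additive) — [BLRNeronModels1990] §1.2
  Prop. 8, [BombieriGubler2006] 10.3.9; `IsAbelianSchemeModel.specialFibreHom h h' f : 𝒜_v ⟶ ℬ_v` — its special fibre, the
  reduction `f̃` of `f` ([Shimura1998] §11.1 Prop. 12), additive and multiplicative (`specialFibreHomAddMonoidHom`,
  `specialFibreEndRingHom`);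
* `IsAbelianSchemeModel.goodReductionAt h : A.GoodReductionAt v` (model `⟨𝒜, e_𝒜⟩`, reduction `𝒜_v`, `reductionIso = refl`,
  lift/reduction of endomorphisms as above — all `rfl`) and `IsAbelianSchemeModel.homReduction h h'` (pair datum, `rfl` fields);
* `IsAbelianSchemeModel.tateSpecialisation h ℓ hℓv` — the `ℓ`-adic specialisation datum along `adicCompletionPrime K v` for
  `ℓ ∉ v` (R-pkg T7a fed by T1/T3/T4/T5/T6′), with `proj_tateSpecialisation_equiv : (T.equiv a)_n = red_v (a_n)`;
* `IsAbelianSchemeModel.isTateCompatible_homReduction_tateSpecialisation` — **[Shimura1998] §11.1 Prop. 14 (i) for produced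
  data: all pair data are Tate-compatible along the one prime `adicCompletionPrime K v`** (Q2);
* `AbelianVariety.exists_goodReductionAt_homReduction_tateSpecialisation_of_isAbelianSchemeModel` (family edition, `ℓ`-free
  data before `∀ ℓ`, witnesses = the accessors, recorded by the clause `R i = (h i).goodReductionAt`) and the cofinite
  edition `exists_finite_forall_exists_goodReductionAt_homReduction_tateSpecialisation` ([Shimura1998] §18.6 shape).

HC_CM is proved only modulo the 7 printed citations until rung 0 closes.

References: [Shimura1998] §11.1 Prop. 12, Prop. 14 (i) (pp. 83, 85), §18.6, §19.4 (19.4a); [SerreTate1968] §1 Lemma 2, Thm. 1;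
[BLRNeronModels1990] §1.2 Def. 1, Prop. 8; [BombieriGubler2006] 10.3.9 (p. 334).
-/

set_option autoImplicit false

noncomputable section

open CategoryTheory CategoryTheory.Limits AlgebraicGeometry IsDedekindDomain IsDedekindDomain.HeightOneSpectrum
open scoped MonObj NumberField CategoryTheory.Obj
open Literature.NumberTheory.EllipticCurves (genericFibre specGenericPoint IsNeronModel TateModule)
open Literature.NumberTheory.GaloisRepresentations (adicCompletionPrime adicCompletionPrime_mem_primesAbove)
open Literature.AlgebraicGeometry.Motives (AbelianVariety SchemeOver)
open Literature.AlgebraicGeometry.Motives.AbelianVariety (GoodReductionAt isNeronModel_of_isAbelianSchemeModel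
  isMonHom_of_isMonHom_genericFibre_map₂ dim_specialFibre_of_isAbelianSchemeModel tateModule_map_bijective_of_geomTorsion)

namespace Literature.NumberTheory.DiophantineGeometry

namespace IsAbelianSchemeModel

variable {K : Type} [Field K] [NumberField K] {v : HeightOneSpectrum (𝓞 K)} {A B C : AbelianVariety K}
  {𝒜 ℬ 𝒞 : SchemeOver (valuationSubringAtPrime K v)} [GrpObj 𝒜] [GrpObj ℬ] [GrpObj 𝒞]

/-! ### The Néron lift of a homomorphism to the models -/

/-- The generic-fibre functor is a bijection `Hom_{𝓞ᵥ}(𝒜, ℬ) ≃ Hom_K(𝒜_K, ℬ_K)` between abelian-scheme models (the Néron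
mapping property of the abelian scheme `ℬ`, `isNeronModel_of_isAbelianSchemeModel`, at the smooth source `𝒜`;
[BLRNeronModels1990] §1.2 Prop. 8). [cite: BLRNeronModels1990, §1.2 Def. 1 and Prop. 8] -/
theorem genericFibre_map_bijective (h : IsAbelianSchemeModel A v 𝒜) (h' : IsAbelianSchemeModel B v ℬ) :
    Function.Bijective fun g : 𝒜 ⟶ ℬ => (genericFibre (valuationSubringAtPrime K v) K).map g := by
  haveI := h.smooth
  haveI : Smooth 𝒜.hom := SmoothOfRelativeDimension.smooth A.dim 𝒜.hom
  exact (isNeronModel_of_isAbelianSchemeModel h').mappingProperty 𝒜 inferInstance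

/-- **The Néron lift** `F = neronLift f : 𝒜 → ℬ` of a homomorphism `f : A → B` to abelian-scheme models `𝒜`, `ℬ` of `A`, `B`
at `v`: the unique morphism of models whose generic fibre is `f` read through the models' CHOSEN generic isomorphisms
`e_𝒜 = h.exists_iso.choose`, `e_ℬ` (i.e. `F_K = e_𝒜 ≫ f ≫ e_ℬ⁻¹`) — [BombieriGubler2006] 10.3.9 «a morphism `Y_K → A` …
extends», [Shimura1998] §11.1 Prop. 12. [cite: BLRNeronModels1990, §1.2 Prop. 8] [cite: BombieriGubler2006, 10.3.9 (p. 334)] -/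
def neronLift (h : IsAbelianSchemeModel A v 𝒜) (h' : IsAbelianSchemeModel B v ℬ) (f : A ⟶ B) : 𝒜 ⟶ ℬ :=
  (Equiv.ofBijective _ (h.genericFibre_map_bijective h')).symm
    (h.exists_iso.choose.hom ≫ f.hom.hom.hom ≫ h'.exists_iso.choose.inv)

/-- The generic fibre of the Néron lift of `f` is `e_𝒜 ≫ f ≫ e_ℬ⁻¹`. [cite: BLRNeronModels1990, §1.2 Prop. 8] -/
theorem genericFibre_map_neronLift (h : IsAbelianSchemeModel A v 𝒜) (h' : IsAbelianSchemeModel B v ℬ) (f : A ⟶ B) :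
    (genericFibre (valuationSubringAtPrime K v) K).map (h.neronLift h' f) =
      h.exists_iso.choose.hom ≫ f.hom.hom.hom ≫ h'.exists_iso.choose.inv :=
  (Equiv.ofBijective _ (h.genericFibre_map_bijective h')).apply_symm_apply _

/-- The generic fibre of the Néron lift of `f`, composed with `e_ℬ`, is `e_𝒜 ≫ f`. [cite: BLRNeronModels1990, §1.2 Prop. 8] -/
theorem genericFibre_map_neronLift_comp (h : IsAbelianSchemeModel A v 𝒜) (h' : IsAbelianSchemeModel B v ℬ) (f : A ⟶ B) :
    (genericFibre (valuationSubringAtPrime K v) K).map (h.neronLift h' f) ≫ h'.exists_iso.choose.hom =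
      h.exists_iso.choose.hom ≫ f.hom.hom.hom := by
  rw [genericFibre_map_neronLift, Category.assoc, Category.assoc, Iso.inv_hom_id, Category.comp_id]

/-- Uniqueness of the Néron lift: a morphism of models with generic fibre `e_𝒜 ≫ f ≫ e_ℬ⁻¹` IS `neronLift f`.
[cite: BLRNeronModels1990, §1.2 Prop. 8] -/
theorem eq_neronLift (h : IsAbelianSchemeModel A v 𝒜) (h' : IsAbelianSchemeModel B v ℬ) (f : A ⟶ B) (g : 𝒜 ⟶ ℬ)
    (hg : (genericFibre (valuationSubringAtPrime K v) K).map g =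
      h.exists_iso.choose.hom ≫ f.hom.hom.hom ≫ h'.exists_iso.choose.inv) : g = h.neronLift h' f := by
  apply (h.genericFibre_map_bijective h').1
  change (genericFibre (valuationSubringAtPrime K v) K).map g =
    (genericFibre (valuationSubringAtPrime K v) K).map (h.neronLift h' f)
  rw [genericFibre_map_neronLift]
  exact hg

/-- The Néron lift of a homomorphism is a homomorphism of group schemes (its generic fibre is one, and the models are
flat and separated: `isMonHom_of_isMonHom_genericFibre_map₂`). [cite: BLRNeronModels1990, §1.2 Prop. 8] -/
theorem isMonHom_neronLift (h : IsAbelianSchemeModel A v 𝒜) (h' : IsAbelianSchemeModel B v ℬ) (f : A ⟶ B) :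
    IsMonHom (h.neronLift h' f) := by
  haveI := h.exists_iso.choose_spec
  haveI := h'.exists_iso.choose_spec
  haveI := h.isProper
  haveI := h'.isProper
  haveI := h.smooth
  haveI := h'.smooth
  haveI : Smooth 𝒜.hom := SmoothOfRelativeDimension.smooth A.dim 𝒜.hom
  haveI : Smooth ℬ.hom := SmoothOfRelativeDimension.smooth B.dim ℬ.hom
  haveI : IsSeparated ℬ.hom := (isNeronModel_of_isAbelianSchemeModel h').isSeparated
  haveI : IsMonHom ((genericFibre (valuationSubringAtPrime K v) K).map (h.neronLift h' f)) := by
    rw [genericFibre_map_neronLift]; infer_instance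
  exact isMonHom_of_isMonHom_genericFibre_map₂ K 𝒜 ℬ (h.neronLift h' f)

/-- `neronLift (𝟙 A) = 𝟙 𝒜`. [cite: BLRNeronModels1990, §1.2 Prop. 8] -/
theorem neronLift_id (h : IsAbelianSchemeModel A v 𝒜) : h.neronLift h (𝟙 A) = 𝟙 𝒜 := by
  refine (h.eq_neronLift h (𝟙 A) (𝟙 𝒜) ?_).symm
  rw [CategoryTheory.Functor.map_id, AbelianVariety.id_hom, Grp.id_hom_hom]
  simp

/-- `neronLift (f ≫ g) = neronLift f ≫ neronLift g`. [cite: BLRNeronModels1990, §1.2 Prop. 8] -/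
theorem neronLift_comp (h : IsAbelianSchemeModel A v 𝒜) (h' : IsAbelianSchemeModel B v ℬ)
    (h'' : IsAbelianSchemeModel C v 𝒞) (f : A ⟶ B) (g : B ⟶ C) :
    h.neronLift h'' (f ≫ g) = h.neronLift h' f ≫ h'.neronLift h'' g := by
  refine (h.eq_neronLift h'' (f ≫ g) _ ?_).symm
  rw [CategoryTheory.Functor.map_comp, genericFibre_map_neronLift, genericFibre_map_neronLift, AbelianVariety.comp_hom,
    Grp.comp_hom_hom]
  simp

/-- `neronLift (f + g) = neronLift f * neronLift g` (pointwise product in `Hom(𝒜, ℬ)`). [cite: BLRNeronModels1990, §1.2 Prop. 8] -/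
theorem neronLift_add (h : IsAbelianSchemeModel A v 𝒜) (h' : IsAbelianSchemeModel B v ℬ) (f g : A ⟶ B) :
    h.neronLift h' (f + g) = h.neronLift h' f * h.neronLift h' g := by
  haveI := h'.exists_iso.choose_spec
  refine (h.eq_neronLift h' (f + g) _ ?_).symm
  rw [Functor.map_mul, genericFibre_map_neronLift, genericFibre_map_neronLift, AbelianVariety.hom_add,
    Grp.Hom.hom_mul, Mon.Hom.hom_mul, MonObj.mul_comp, MonObj.comp_mul]

/-! ### The special fibre of the Néron lift: reduction of homomorphisms -/

/-- **The reduction `f̃ : 𝒜_v → ℬ_v` of a homomorphism `f : A → B`** at abelian-scheme models: the special fibre of its Néron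
lift, as a homomorphism of the special-fibre abelian varieties ([Shimura1998] §11.1 Prop. 12 «the reduction `λ̃` of `λ`»).
[cite: Shimura1998, §11.1 Prop. 12] [cite: BombieriGubler2006, 10.3.9 (p. 334)] -/
def specialFibreHom (h : IsAbelianSchemeModel A v 𝒜) (h' : IsAbelianSchemeModel B v ℬ) (f : A ⟶ B) :
    h.specialFibre ⟶ h'.specialFibre :=
  haveI := h.isMonHom_neronLift h' f
  InducedCategory.homMk ((specialFibreFunctor v).mapGrp.map (Grp.ofHom (h.neronLift h' f)))

/-- The group-scheme morphism underlying `specialFibreHom f` is the special fibre of the Néron lift (by `rfl`).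
[cite: Shimura1998, §11.1 Prop. 12] -/
theorem specialFibreHom_hom_hom_hom (h : IsAbelianSchemeModel A v 𝒜) (h' : IsAbelianSchemeModel B v ℬ) (f : A ⟶ B) :
    (h.specialFibreHom h' f).hom.hom.hom = (specialFibreFunctor v).map (h.neronLift h' f) := rfl

/-- `(𝟙 A)~ = 𝟙`. [cite: Shimura1998, §11.1 Prop. 12] -/
theorem specialFibreHom_id (h : IsAbelianSchemeModel A v 𝒜) : h.specialFibreHom h (𝟙 A) = 𝟙 h.specialFibre := by
  apply AbelianVariety.hom_ext
  rw [specialFibreHom_hom_hom_hom, neronLift_id]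
  exact (specialFibreFunctor v).map_id _

/-- `(f ≫ g)~ = f̃ ≫ g̃`. [cite: Shimura1998, §11.1 Prop. 12] -/
theorem specialFibreHom_comp (h : IsAbelianSchemeModel A v 𝒜) (h' : IsAbelianSchemeModel B v ℬ)
    (h'' : IsAbelianSchemeModel C v 𝒞) (f : A ⟶ B) (g : B ⟶ C) :
    h.specialFibreHom h'' (f ≫ g) = h.specialFibreHom h' f ≫ h'.specialFibreHom h'' g := by
  apply AbelianVariety.hom_ext
  rw [specialFibreHom_hom_hom_hom, h.neronLift_comp h' h'', CategoryTheory.Functor.map_comp]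
  rfl

/-- `(f + g)~ = f̃ + g̃` («`λ ↦ λ̃` is additive», [Shimura1998] §11.1 Prop. 12). [cite: Shimura1998, §11.1 Prop. 12] -/
theorem specialFibreHom_add (h : IsAbelianSchemeModel A v 𝒜) (h' : IsAbelianSchemeModel B v ℬ) (f g : A ⟶ B) :
    h.specialFibreHom h' (f + g) = h.specialFibreHom h' f + h.specialFibreHom h' g := by
  apply AbelianVariety.hom_ext
  rw [specialFibreHom_hom_hom_hom, neronLift_add]
  exact Functor.map_mul (specialFibreFunctor v) _ _

/-- `0~ = 0`. [cite: Shimura1998, §11.1 Prop. 12] -/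
theorem specialFibreHom_zero (h : IsAbelianSchemeModel A v 𝒜) (h' : IsAbelianSchemeModel B v ℬ) :
    h.specialFibreHom h' 0 = 0 := by
  have h0 := h.specialFibreHom_add h' 0 0
  rw [add_zero] at h0
  exact left_eq_add.mp h0

/-- Reduction of homomorphisms as an additive map `Hom(A, B) →+ Hom(𝒜_v, ℬ_v)`. [cite: Shimura1998, §11.1 Prop. 12] -/
def specialFibreHomAddMonoidHom (h : IsAbelianSchemeModel A v 𝒜) (h' : IsAbelianSchemeModel B v ℬ) :
    (A ⟶ B) →+ (h.specialFibre ⟶ h'.specialFibre) where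
  toFun := h.specialFibreHom h'
  map_zero' := h.specialFibreHom_zero h'
  map_add' := h.specialFibreHom_add h'

/-- Reduction of endomorphisms as a ring homomorphism `End A →+* End 𝒜_v` («if `A = B`, this is a ring-injection»,
[Shimura1998] §11.1 Prop. 12). [cite: Shimura1998, §11.1 Prop. 12] -/
def specialFibreEndRingHom (h : IsAbelianSchemeModel A v 𝒜) : End A →+* End h.specialFibre :=
  RingHom.mk' ⟨⟨h.specialFibreHom h, h.specialFibreHom_id⟩, fun f g => h.specialFibreHom_comp h h g f⟩
    (h.specialFibreHom_add h)

/-! ### The produced good-reduction datum and reduction-of-homomorphisms datum -/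

/-- **The good-reduction datum PRODUCED by an abelian-scheme model** `𝒜` of `A` at `v`: model `⟨𝒜, e_𝒜⟩`, reduction the
special fibre `𝒜_v` (identity `reductionIso`), lift of endomorphisms the Néron lift, reduction of endomorphisms its special
fibre ([BombieriGubler2006] 10.3.9; the datum of `exists_goodReductionAt_of_isAbelianSchemeModel`, now NAMED so that further
data — pair data, `ℓ`-adic specialisations, Frobenius conjugates — can refer to one and the same `R`).
[cite: BombieriGubler2006, 10.3.9 (p. 334)] [cite: Shimura1998, §11.1 Prop. 12] -/
abbrev goodReductionAt (h : IsAbelianSchemeModel A v 𝒜) : A.GoodReductionAt v where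
  model := ⟨𝒜, h.exists_iso.choose⟩
  isSmoothProper := ⟨h.smooth, h.isProper⟩
  reduction := h.specialFibre
  reductionIso := Iso.refl _
  dim_reduction := dim_specialFibre_of_isAbelianSchemeModel h
  liftEnd f := h.neronLift h f
  liftEnd_left_comp f := by
    have h2 := congrArg CommaMorphism.left (h.genericFibre_map_neronLift_comp h f)
    simp only [Over.comp_left] at h2
    exact h2
  redEnd := h.specialFibreEndRingHom
  redEnd_left_comp f := by
    change ((specialFibreFunctor v).map (h.neronLift h f)).left ≫ 𝟙 _ =
      𝟙 _ ≫ ((specialFibreFunctor v).map (h.neronLift h f)).left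
    simp

/-- The model of the produced datum is `𝒜` (by `rfl`). [cite: BombieriGubler2006, 10.3.9 (p. 334)] -/
@[simp] theorem goodReductionAt_model_total (h : IsAbelianSchemeModel A v 𝒜) : h.goodReductionAt.model.total = 𝒜 := rfl

/-- The reduction of the produced datum is the special fibre `𝒜_v` (by `rfl`). [cite: BombieriGubler2006, 10.3.9 (p. 334)] -/
@[simp] theorem goodReductionAt_reduction (h : IsAbelianSchemeModel A v 𝒜) :
    h.goodReductionAt.reduction = h.specialFibre := rfl

/-- The lift of endomorphisms of the produced datum is the Néron lift (by `rfl`). [cite: BombieriGubler2006, 10.3.9 (p. 334)] -/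
@[simp] theorem goodReductionAt_liftEnd (h : IsAbelianSchemeModel A v 𝒜) (f : End A) :
    h.goodReductionAt.liftEnd f = h.neronLift h f := rfl

/-- The reduction of endomorphisms of the produced datum is `specialFibreHom` (by `rfl`). [cite: Shimura1998, §11.1 Prop. 12] -/
@[simp] theorem goodReductionAt_redEnd (h : IsAbelianSchemeModel A v 𝒜) (f : End A) :
    h.goodReductionAt.redEnd f = h.specialFibreHom h f := rfl

/-- **The reduction-of-homomorphisms datum PRODUCED by two abelian-scheme models** at `v` (pair data for the produced
good-reduction data `h.goodReductionAt`, `h'.goodReductionAt`): lift = Néron lift, reduction = its special fibre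
([Shimura1998] §11.1 Prop. 12; the datum of `exists_goodReductionAt_homReduction_of_isAbelianSchemeModel`, NAMED).
[cite: Shimura1998, §11.1 Prop. 12] [cite: BombieriGubler2006, 10.3.9 (p. 334)] -/
def homReduction (h : IsAbelianSchemeModel A v 𝒜) (h' : IsAbelianSchemeModel B v ℬ) :
    GoodReductionAt.HomReduction h.goodReductionAt h'.goodReductionAt where
  liftHom := h.neronLift h'
  liftHom_left_comp f := by
    have h2 := congrArg CommaMorphism.left (h.genericFibre_map_neronLift_comp h' f)
    simp only [Over.comp_left] at h2
    exact h2
  redHom := h.specialFibreHomAddMonoidHom h'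
  redHom_left_comp f := by
    change ((specialFibreFunctor v).map (h.neronLift h' f)).left ≫ 𝟙 _ =
      𝟙 _ ≫ ((specialFibreFunctor v).map (h.neronLift h' f)).left
    simp
  redEnd_comp_redHom g f := h.specialFibreHom_comp h h' g f
  redHom_comp_redEnd f g := h.specialFibreHom_comp h' h' f g

/-- The lift of the produced pair datum is the Néron lift (by `rfl`). [cite: Shimura1998, §11.1 Prop. 12] -/
@[simp] theorem homReduction_liftHom (h : IsAbelianSchemeModel A v 𝒜) (h' : IsAbelianSchemeModel B v ℬ) (f : A ⟶ B) :
    (h.homReduction h').liftHom f = h.neronLift h' f := rfl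

/-- The reduction of the produced pair datum is `specialFibreHom` (by `rfl`). [cite: Shimura1998, §11.1 Prop. 12] -/
@[simp] theorem homReduction_redHom (h : IsAbelianSchemeModel A v 𝒜) (h' : IsAbelianSchemeModel B v ℬ) (f : A ⟶ B) :
    (h.homReduction h').redHom f = h.specialFibreHom h' f := rfl

/-! ### The reduction map is natural for the Néron lift; the `ℓ`-adic specialisation datum -/

/-- **`red_v` commutes with homomorphisms and their reductions**: `red_v (f x) = f̃ (red_v x)` for `f : A → B`, `f̃` its
reduction at abelian-scheme models (the union file's two-model naturality `specialFibreReductionHom_geomPointsMap` at the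
Néron lift, whose two hypotheses hold by construction). [cite: Shimura1998, §11.1 Prop. 12 and Prop. 14 (i)] -/
theorem specialFibreReductionHom_geomPointsMap_specialFibreHom (h : IsAbelianSchemeModel A v 𝒜)
    (h' : IsAbelianSchemeModel B v ℬ) (f : A ⟶ B) (x : A.geomPoints) :
    h'.specialFibreReductionHom (AbelianVariety.Hom.geomPointsMap f x) =
      AbelianVariety.Hom.geomPointsMap (h.specialFibreHom h' f) (h.specialFibreReductionHom x) :=
  h.specialFibreReductionHom_geomPointsMap h' f (h.neronLift h' f) (h.specialFibreHom h' f)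
    (h.genericFibre_map_neronLift_comp h' f) rfl x

/-- **The produced datum carries an `ℓ`-adic specialisation datum along `adicCompletionPrime K v` for every `ℓ ∉ v`, whose
reduction isomorphism is `T_ℓ(red_v)` on the nose** (R-pkg T7a `exists_tateSpecialisation_of_reductionMap` at
`red_v = h.specialFibreReductionHom`, fed by T1 `specialFibreReductionHom_injOn/bijOn_geomTorsion_pow` (Serre–Tate Lemma 2),
T3 `tateModule_map_bijective_of_geomTorsion`, T4 `forall_smul_eq_self_of_mem_inertia_of_injOn` (inertia), T5
`specialFibreReductionHom_smul_of_isArithFrobAt` ((19.4a)) and the naturality above for `hend`).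
[cite: SerreTate1968, §1 Lemma 2 and Thm. 1] [cite: Shimura1998, §11.1 Prop. 14 (i); §19.4 (19.4a)] -/
theorem exists_tateSpecialisation (h : IsAbelianSchemeModel A v 𝒜) (ℓ : ℕ) [Fact ℓ.Prime]
    (hℓv : ((ℓ : ℕ) : 𝓞 K) ∉ v.asIdeal) :
    ∃ T : h.goodReductionAt.TateSpecialisation ℓ, T.prime = adicCompletionPrime K v ∧
      ∀ (a : A.tateModule ℓ) (n : ℕ),
        TateModule.proj ℓ n (T.equiv a) = h.specialFibreReductionHom (TateModule.proj ℓ n a) := by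
  have hinj : ∀ n : ℕ, Set.InjOn h.specialFibreReductionHom (A.geomTorsion (ℓ ^ n : ℕ) : Set A.geomPoints) :=
    fun n => h.specialFibreReductionHom_injOn_geomTorsion_pow hℓv n
  exact GoodReductionAt.exists_tateSpecialisation_of_reductionMap h.goodReductionAt ℓ (adicCompletionPrime K v)
    (adicCompletionPrime_mem_primesAbove K v) h.specialFibreReductionHom
    (tateModule_map_bijective_of_geomTorsion h.specialFibreReductionHom hinj fun n =>
      (h.specialFibreReductionHom_bijOn_geomTorsion_pow hℓv n).surjOn)
    (h.forall_smul_eq_self_of_mem_inertia_of_injOn ℓ hinj)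
    (fun _ _ hσ x _ => h.specialFibreReductionHom_smul_of_isArithFrobAt hσ x)
    (fun _ f x _ => h.specialFibreReductionHom_geomPointsMap_specialFibreHom h (f : A ⟶ A) x)

/-- **The `ℓ`-adic specialisation datum PRODUCED by an abelian-scheme model** at `v`, for `ℓ ∉ v` (a choice from
`exists_tateSpecialisation`; its prime and its reduction isomorphism are pinned down by `tateSpecialisation_prime` and
`proj_tateSpecialisation_equiv`, so the choice is immaterial). [cite: Shimura1998, §11.1 Prop. 14 (i); §19.4 (19.4a)]
[cite: SerreTate1968, §1 Lemma 2 and Thm. 1] -/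
def tateSpecialisation (h : IsAbelianSchemeModel A v 𝒜) (ℓ : ℕ) [Fact ℓ.Prime] (hℓv : ((ℓ : ℕ) : 𝓞 K) ∉ v.asIdeal) :
    h.goodReductionAt.TateSpecialisation ℓ :=
  (h.exists_tateSpecialisation ℓ hℓv).choose

/-- The produced specialisation datum reduces along `adicCompletionPrime K v` (the prime of `K̄` under the chosen embedding
`K̄ → K̄ᵥ`). [cite: Shimura1998, §19.4 (19.4a)] -/
@[simp] theorem tateSpecialisation_prime (h : IsAbelianSchemeModel A v 𝒜) (ℓ : ℕ) [Fact ℓ.Prime]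
    (hℓv : ((ℓ : ℕ) : 𝓞 K) ∉ v.asIdeal) : (h.tateSpecialisation ℓ hℓv).prime = adicCompletionPrime K v :=
  (h.exists_tateSpecialisation ℓ hℓv).choose_spec.1

/-- **The reduction isomorphism of the produced specialisation datum is `T_ℓ(red_v)`**: componentwise,
`(T.equiv a)_n = red_v (a_n)`. [cite: Shimura1998, §11.1 Prop. 14 (i); §19.4 (19.4a)] -/
theorem proj_tateSpecialisation_equiv (h : IsAbelianSchemeModel A v 𝒜) (ℓ : ℕ) [Fact ℓ.Prime]
    (hℓv : ((ℓ : ℕ) : 𝓞 K) ∉ v.asIdeal) (a : A.tateModule ℓ) (n : ℕ) :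
    TateModule.proj ℓ n ((h.tateSpecialisation ℓ hℓv).equiv a) =
      h.specialFibreReductionHom (TateModule.proj ℓ n a) :=
  (h.exists_tateSpecialisation ℓ hℓv).choose_spec.2 a n

/-! ### Shimura Prop. 14 (i) for produced data: Tate compatibility of all pair data along one prime -/

/-- **«`M_l(λ) = M_l(λ̃)` for every `λ ∈ Hom(A, B; k)`, one `𝔭'` for all»** ([Shimura1998] §11.1 Prop. 14 (i)) for PRODUCED
data: the produced pair datum of two abelian-scheme models at `v` is Tate-compatible with their produced `ℓ`-adic
specialisation data (which all reduce along the same prime `adicCompletionPrime K v`).  Componentwise this is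
`red_v (f a_n) = f̃ (red_v a_n)` (`specialFibreReductionHom_geomPointsMap_specialFibreHom`).
[cite: Shimura1998, §11.1 Prop. 14 (i)] -/
theorem isTateCompatible_homReduction_tateSpecialisation (h : IsAbelianSchemeModel A v 𝒜)
    (h' : IsAbelianSchemeModel B v ℬ) (ℓ : ℕ) [Fact ℓ.Prime] (hℓv : ((ℓ : ℕ) : 𝓞 K) ∉ v.asIdeal) :
    (h.homReduction h').IsTateCompatible (h.tateSpecialisation ℓ hℓv) (h'.tateSpecialisation ℓ hℓv) := by
  intro f a
  refine TateModule.ext fun n => ?_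
  rw [proj_tateSpecialisation_equiv, AbelianVariety.proj_tateModuleMap, AbelianVariety.proj_tateModuleMap,
    proj_tateSpecialisation_equiv, homReduction_redHom]
  exact h.specialFibreReductionHom_geomPointsMap_specialFibreHom h' f _

end IsAbelianSchemeModel

end Literature.NumberTheory.DiophantineGeometry

/-! ### The family edition (E4-P6′ / Q0–Q2): R, H and T for a family of abelian-scheme models, jointly -/

namespace Literature.AlgebraicGeometry.Motives

namespace AbelianVariety

open Literature.NumberTheory.DiophantineGeometry

variable {K : Type} [Field K] [NumberField K] {v : HeightOneSpectrum (𝓞 K)} {J : Type*}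

/-- **Simultaneous `ℓ`-adic specialisation of a family, Tate-compatible along ONE prime, in the produced currency**
([Shimura1998] §11.1 Prop. 14 (i) «we can choose l-adic coordinate-systems … in such a way that (i) for every
`λ ∈ Hom(A, B; k)`, `M_l(λ) = M_l(λ̃)`», with the reduction modulo one `𝔭'` for all members; [SerreTate1968] §1): for
abelian-scheme models `𝒜 i` of `A i` at `v` there are good-reduction data `R i` (model `𝒜 i`, reduction `(𝒜 i)_v`) and pair
data `H i j` such that FOR EVERY prime `ℓ ∉ v` there are `ℓ`-adic specialisation data `T i` along the common prime
`adicCompletionPrime K v`, pairwise Tate-compatible with the `H i j`.  Witnesses: the NAMED produced data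
`(h i).goodReductionAt` (recorded as the clause `R i = (h i).goodReductionAt`), `(h i).homReduction (h j)`,
`(h i).tateSpecialisation ℓ hℓv` (whose `equiv` is `T_ℓ(red_v)`, `proj_tateSpecialisation_equiv`) — so further data over the
same `R` (Frobenius conjugates, their specialisations) can be adjoined by later files, by name.
[cite: Shimura1998, §11.1 Prop. 14 (i)] [cite: SerreTate1968, §1 Lemma 2 and Thm. 1] -/
theorem exists_goodReductionAt_homReduction_tateSpecialisation_of_isAbelianSchemeModel (A : J → AbelianVariety K)
    (𝒜 : J → SchemeOver (valuationSubringAtPrime K v)) [∀ i, GrpObj (𝒜 i)]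
    (h : ∀ i, IsAbelianSchemeModel (A i) v (𝒜 i)) :
    ∃ (R : ∀ i, (A i).GoodReductionAt v) (H : ∀ i j, GoodReductionAt.HomReduction (R i) (R j)),
      (∀ i, (R i).model.total = 𝒜 i ∧ (R i).reduction = (h i).specialFibre) ∧
      (∀ i, R i = (h i).goodReductionAt) ∧
      ∀ (ℓ : ℕ) [Fact ℓ.Prime], ((ℓ : ℕ) : 𝓞 K) ∉ v.asIdeal →
        ∃ T : ∀ i, (R i).TateSpecialisation ℓ,
          (∀ i, (T i).prime = adicCompletionPrime K v) ∧
          ∀ i j, (H i j).IsTateCompatible (T i) (T j) :=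
  ⟨fun i => (h i).goodReductionAt, fun i j => (h i).homReduction (h j), fun _ => ⟨rfl, rfl⟩, fun _ => rfl,
    fun ℓ _ hℓv => ⟨fun i => (h i).tateSpecialisation ℓ hℓv, fun i => (h i).tateSpecialisation_prime ℓ hℓv,
      fun i j => (h i).isTateCompatible_homReduction_tateSpecialisation (h j) ℓ hℓv⟩⟩

/-- **Cofinite family edition**: for finitely many abelian varieties `A i` over `K` there is a finite set `S` of places
outside which abelian-scheme models exist for all `i` (`exists_finite_forall_exists_isAbelianSchemeModel`), hence
good-reduction data, pair data and — for every `ℓ ∉ v` — `ℓ`-adic specialisation data along one common prime,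
pairwise Tate-compatible ([Shimura1998] §11.1 «for almost all `𝔭`» and Prop. 14 (i); the shape consumed in the proof of
the main theorem of complex multiplication, §18.6). [cite: Shimura1998, §11.1 Prop. 14 (i) and §18.6]
[cite: SerreTate1968, §1 Lemma 2 and Thm. 1] -/
theorem exists_finite_forall_exists_goodReductionAt_homReduction_tateSpecialisation [Finite J]
    (A : J → AbelianVariety K) :
    ∃ S : Set (HeightOneSpectrum (𝓞 K)), S.Finite ∧ ∀ v ∉ S,
      ∃ (R : ∀ i, (A i).GoodReductionAt v) (H : ∀ i j, GoodReductionAt.HomReduction (R i) (R j)),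
        ∀ (ℓ : ℕ) [Fact ℓ.Prime], ((ℓ : ℕ) : 𝓞 K) ∉ v.asIdeal →
          ∃ T : ∀ i, (R i).TateSpecialisation ℓ,
            (∀ i, (T i).prime = Literature.NumberTheory.GaloisRepresentations.adicCompletionPrime K v) ∧
            ∀ i j, (H i j).IsTateCompatible (T i) (T j) := by
  classical
  choose S hS hmod using fun i => exists_finite_forall_exists_isAbelianSchemeModel (A i)
  refine ⟨⋃ i, S i, Set.finite_iUnion hS, fun v hv => ?_⟩
  have hv' : ∀ i, v ∉ S i := fun i hvi => hv (Set.mem_iUnion.mpr ⟨i, hvi⟩)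
  choose 𝒜 inst h𝒜 using fun i => hmod i v (hv' i)
  obtain ⟨R, H, -, -, hT⟩ := exists_goodReductionAt_homReduction_tateSpecialisation_of_isAbelianSchemeModel A 𝒜 h𝒜
  exact ⟨R, H, fun ℓ _ hℓv => hT ℓ hℓv⟩

end AbelianVariety

end Literature.AlgebraicGeometry.Motives

end
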